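import Summits.ResolutionOfSingularities.ResolutionOfSingularities.Theorems.WildConesCampaignW46ThreefoldsCharTwo
import Summits.ResolutionOfSingularities.ResolutionOfSingularities.Theorems.JacobianBudgetIsolatedJacobianDropCharTwo

/-!
# [OURS · L1 W4.6, rung (ii) at p = 2] EXACT Milnor drop for threefold hypersurface double points in
# characteristic two: `μ(successor) + 2 = μ(state)` at every forced double step — hence the SHARP
# effective bound `2M + 1 ≤ μ(c₀)` on forced double prefixes (calibrated by the family
# `u₀u₁ + u₂^(2j+1)` of `Theorems/WildConesCampaignW46ThreefoldsCharTwoFamily.lean`, where `μ = 2j`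
# carries exactly `j` forced double states)

Cell res-hironaka (LADDER-RESOLUTION rung L, D-0089), slot W4.6, seat res-L1-s46-pv-4; host route
`WildCones`, crux `ClassicalRegimes` (stmt-ResolutionOfSingularities-16884). Everything here is OURS, about
the route's TYPED point-blow-up dynamics (`Theorems/WildConesClassicalRegimesDefs.lean`); NOTHING is a
statement of H. Hironaka's manuscript [Hironaka2017]. AI review is weaker than expert review.

CONTENT. The tree's hyperbolic-pair descent (`MuDropCharTwoOrdP.*`, Greuel–Pfister [GreuelPfister2026]
Thm 3.5 / Cor 3.7 for the pair, folklore otherwise) proves a STRICT drop `μ' < μ` in every dimension,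
and route JacobianBudget's char-two budget file (`JacobianBudget.CharTwo.mu_step_add_two_eq`,
`Theorems/JacobianBudgetIsolatedJacobianDropCharTwo.lean`) the EXACT law `μ' + 2 = μ` for every ODD `n`
under `Isol` of both states. Here, for `n = 3`: the exact law WITHOUT assuming the state itself
isolated (`formal_drop_eq_three`: pair exists ⇒ `descent_package` to the curve leaf
`JacobianBudget.CharTwo.curve_drop_eq`, whose only finiteness input is the successor's; no pair ⇒ Case
A, `caseA_not_finite`), so that isolatedness PROPAGATES BACKWARDS along forced double steps
(`threefold_isol_of_forcedSuccessor`); `threefold_muDrop_eq` (through the char-two dictionary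
`dictCharTwo`). Consequences: along a forced double prefix `μ(state m) + 2m = μ(c₀)`
(`threefold_mu_add_two_mul_eq`), so `2M + 1 ≤ μ(c₀)` (`threefold_two_mul_forcedPrefix_lt_mu`; `μ ≥ 1` at
the last forced state by `mu_pos`), i.e. at most `⌈μ(c₀)/2⌉` consecutive forced double states — halving
the rung file's `forcedPrefix_lt_mu`, and attained by the family (`μ = 2j`, `j` states, `2(j−1)+1 < 2j`).
-/

noncomputable section

-- single-problem summit: the doubled namespace component `ResolutionOfSingularities` is forced
set_option linter.dupNamespace false

open scoped BigOperators Classical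

open MvPowerSeries

open Literature.AlgebraicGeometry.Resolution

namespace Summit.ResolutionOfSingularities.ResolutionOfSingularities.Theorems

namespace CampaignW46.ThreefoldsCharTwo

open WildCones WildCones.MuDropCharTwoOrdP

variable {κ : Type} [Field κ]

/-- **The formal EXACT drop in three variables** (characteristic two): for `a ∈ κ⟦X₀,X₁,X₂⟧` of order
`≥ 2` and `G` without linear terms with `X_i² G = a∘Φ_{i,τ}` and the Milnor algebra of `G` finite (that
of `a` is then finite as well — its dimension comes out positive), `dim κ⟦X⟧/(∂G) + 2 = dim κ⟦X⟧/(∂a)`.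
If the quadratic part of `a` has a square-free monomial, one
avoiding the chart index exists (`exists_pair_ne`) and `descent_package` carries both Milnor algebras
isomorphically to ONE variable, where `JacobianBudget.CharTwo.curve_drop_eq` applies; otherwise the
successor is not isolated (`caseA_not_finite`). The `n = 3`, successor-finiteness-only instance of
`JacobianBudget.CharTwo.formal_drop_odd`. [cite: GreuelPfister2026, Thm 3.5 and Cor 3.7] -/
theorem formal_drop_eq_three [CharP κ 2] (i : Fin 3) (τ : Fin 3 → κ) {a G : MvPowerSeries (Fin 3) κ}
    (ha : 2 ≤ a.order) (hG0 : ∀ s, coeff (Finsupp.single s 1) G = 0)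
    (hG : X i ^ 2 * G = subst (fun s => if s = i then (X i : MvPowerSeries (Fin 3) κ)
      else X i * (X s + C (τ s))) a)
    (hfG : Module.Finite κ (MvPowerSeries (Fin 3) κ ⧸
      Ideal.span (Set.range fun s => MvPowerSeries.pderiv s G))) :
    Module.finrank κ (MvPowerSeries (Fin 3) κ ⧸
        Ideal.span (Set.range fun s => MvPowerSeries.pderiv s G)) + 2 =
      Module.finrank κ (MvPowerSeries (Fin 3) κ ⧸
        Ideal.span (Set.range fun s => MvPowerSeries.pderiv s a)) := by
  by_cases hpair : ∃ j l : Fin 3, j ≠ l ∧ coeff (Finsupp.single j 1 + Finsupp.single l 1) a ≠ 0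
  · obtain ⟨j, l, hjl, hj, hl, hq⟩ := exists_pair_ne i τ ha hG hG0 hpair
    obtain ⟨i', τ', a', G', -, -, -, hG', -, hfG', hμa, hμG⟩ :=
      descent_package i τ ha hG0 hG hjl hj hl hq
    rw [← hμa, ← hμG]
    exact JacobianBudget.CharTwo.curve_drop_eq i' τ' hG' (hfG' hfG)
  · push Not at hpair
    exact absurd hfG (caseA_not_finite le_rfl i τ ha hG hG0 fun j l hjl => hpair j l hjl)

/-- [OURS · L1 W4.6 rung (ii) at `p = 2`; NOT a statement of the manuscript] **EXACT Milnor drop for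
threefold hypersurface double points**: over any field of characteristic `2`, if a state of
`z² = a(u₀,u₁,u₂)` has multiplicity two and its point-blow-up successor is an isolated double point,
then `μ(successor) + 2 = μ(state)` — the Milnor number falls by EXACTLY two at every forced double step
(sharpening `threefold_muDrop`; the state's own isolatedness is not assumed, it follows:
`threefold_isol_of_forcedSuccessor`). The char-two dictionary `dictCharTwo` and `formal_drop_eq_three`.
[cite: GreuelPfister2026, Thm 3.5 and Cor 3.7] -/
theorem threefold_muDrop_eq (κ : Type) [Field κ] [CharP κ 2] (c : (Fin 3 → ℕ) → κ) (i : Fin 3)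
    (τ : Fin 3 → κ) (hM : MultP 2 3 κ c) (hI' : Isol 2 3 κ (step 2 3 κ i τ c))
    (hM' : MultP 2 3 κ (step 2 3 κ i τ c)) : mu 2 3 κ (step 2 3 κ i τ c) + 2 = mu 2 3 κ c := by
  obtain ⟨G, ha, hG0, hG, hj, hj'⟩ := dictCharTwo c i τ hM hM'
  change Module.Finite κ (MvPowerSeries (Fin 3) κ ⧸ jac 2 3 κ (step 2 3 κ i τ c)) at hI'
  change Module.finrank κ (MvPowerSeries (Fin 3) κ ⧸ jac 2 3 κ (step 2 3 κ i τ c)) + 2 =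
    Module.finrank κ (MvPowerSeries (Fin 3) κ ⧸ jac 2 3 κ c)
  rw [hj]
  rw [hj'] at hI' ⊢
  exact formal_drop_eq_three i τ ha hG0 hG hI'

/-- [OURS · L1 W4.6 rung (ii) at `p = 2`; NOT a statement of the manuscript] **Forced double successors
come only from isolated states** (threefold hypersurfaces, characteristic `2`): if a state of
`z² = a(u₀,u₁,u₂)` of multiplicity two has an isolated double point as point-blow-up successor, the
state itself is an isolated singularity — its Milnor number is `μ(successor) + 2 > 0`. [folklore] -/
theorem threefold_isol_of_forcedSuccessor (κ : Type) [Field κ] [CharP κ 2] (c : (Fin 3 → ℕ) → κ)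
    (i : Fin 3) (τ : Fin 3 → κ) (hM : MultP 2 3 κ c) (hI' : Isol 2 3 κ (step 2 3 κ i τ c))
    (hM' : MultP 2 3 κ (step 2 3 κ i τ c)) : Isol 2 3 κ c := by
  have h := threefold_muDrop_eq κ c i τ hM hI' hM'
  have hpos : 0 < mu 2 3 κ c := by omega
  exact Module.finite_of_finrank_pos hpos

/-- [OURS · L1 W4.6 rung (ii) at `p = 2`; NOT a statement of the manuscript] **Along a forced double
prefix `μ` falls by exactly two per step**: if the states `0, …, M` of a run of `z² = a(u₀,u₁,u₂)`
(characteristic `2`, any field) are isolated double points then `μ(state m) + 2m = μ(c₀)` for every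
`m ≤ M`. [folklore] -/
theorem threefold_mu_add_two_mul_eq (κ : Type) [Field κ] [CharP κ 2] (c₀ : (Fin 3 → ℕ) → κ)
    (i : ℕ → Fin 3) (t : ℕ → Fin 3 → κ) {M : ℕ}
    (hpre : ∀ m ≤ M, Isol 2 3 κ (run 2 3 κ c₀ i t m) ∧ MultP 2 3 κ (run 2 3 κ c₀ i t m)) :
    ∀ m ≤ M, mu 2 3 κ (run 2 3 κ c₀ i t m) + 2 * m = mu 2 3 κ c₀ := by
  intro m
  induction m with
  | zero => intro _; rfl
  | succ m ih =>
    intro hm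
    have hdrop : mu 2 3 κ (run 2 3 κ c₀ i t (m + 1)) + 2 = mu 2 3 κ (run 2 3 κ c₀ i t m) :=
      threefold_muDrop_eq κ _ (i m) (t m) (hpre m (by omega)).2 (hpre (m + 1) hm).1 (hpre (m + 1) hm).2
    have := ih (by omega)
    omega

/-- [OURS · L1 W4.6 rung (ii) at `p = 2`, SHARP effective bound; NOT a statement of the manuscript]
**At most `⌈μ(c₀)/2⌉` consecutive forced double states**: if the states `0, …, M` of a run of
`z² = a(u₀,u₁,u₂)` over a field of characteristic `2` are isolated double points then
`2M + 1 ≤ μ(c₀)` (exact drop by two, and `μ ≥ 1` at the last forced state by `mu_pos`). Attained by the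
family `u₀u₁ + u₂^(2j+1)` (`μ = 2j`, exactly `j` forced double states:
`Theorems/WildConesCampaignW46ThreefoldsCharTwoFamily.lean`). [folklore] -/
theorem threefold_two_mul_forcedPrefix_lt_mu (κ : Type) [Field κ] [CharP κ 2] (c₀ : (Fin 3 → ℕ) → κ)
    (i : ℕ → Fin 3) (t : ℕ → Fin 3 → κ) {M : ℕ}
    (hpre : ∀ m ≤ M, Isol 2 3 κ (run 2 3 κ c₀ i t m) ∧ MultP 2 3 κ (run 2 3 κ c₀ i t m)) :
    2 * M + 1 ≤ mu 2 3 κ c₀ := by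
  have hM := threefold_mu_add_two_mul_eq κ c₀ i t hpre M le_rfl
  have hpos := mu_pos (p := 2) le_rfl (hpre M le_rfl).1 (hpre M le_rfl).2
  omega

/-- [OURS · L1 W4.6 rung (ii) at `p = 2`; NOT a statement of the manuscript] **Exit within
`⌈μ(c₀)/2⌉` steps**: along every chart/translation word some state of index `≤ (μ(c₀) + 1)/2` of the
run of `z² = a(u₀,u₁,u₂)` (characteristic `2`) is not a forced double state (halving
`threefold_exists_exit_le_mu`; for the family `u₀u₁ + u₂^(2j+1)`, `μ = 2j`, the exit IS at index `j`).
[folklore] -/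
theorem threefold_exists_exit_le_half (κ : Type) [Field κ] [CharP κ 2] (c₀ : (Fin 3 → ℕ) → κ)
    (i : ℕ → Fin 3) (t : ℕ → Fin 3 → κ) :
    ∃ m ≤ (mu 2 3 κ c₀ + 1) / 2,
      ¬ (Isol 2 3 κ (run 2 3 κ c₀ i t m) ∧ MultP 2 3 κ (run 2 3 κ c₀ i t m)) := by
  by_contra h
  have hpre : ∀ m ≤ (mu 2 3 κ c₀ + 1) / 2,
      Isol 2 3 κ (run 2 3 κ c₀ i t m) ∧ MultP 2 3 κ (run 2 3 κ c₀ i t m) := fun m hm => by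
    by_contra h'
    exact h ⟨m, hm, h'⟩
  have hb := threefold_two_mul_forcedPrefix_lt_mu κ c₀ i t hpre
  omega

end CampaignW46.ThreefoldsCharTwo

end Summit.ResolutionOfSingularities.ResolutionOfSingularities.Theorems

end
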